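import Summits.ResolutionOfSingularities.ResolutionOfSingularities.Theorems.PurelyInseparableDim4ParamCertNineSound
import HarnessLib

/-!
# [OURS · res-dim4-pi · F4-C-loc] PARAMETRIC CERTIFICATES, format v10: the ι-TORUS row — the letter pinned to `β² = −1`
  and the resulting `ι`-VALUED family scaled back to a RATIONAL state by the torus (`β⁴ = 1`)

Cell `res-dim4-pi` (D-0157 DOOR 2, wave 2), seat `res-dim4-p-6` g4; sequel of `…ParamCertEight` (quadratic pins) and
`…LocalGameTorus`.  The last FAIL row of the 2-monomial census (idx 3552, `x₀x₁x₂³x₃³ + x₀³x₁³x₂x₃`) pins B's letter to a square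
root of `−1` with an `ι`-dependent reduced family.  When every monomial of that family carries a PURE power of the letter
(after `reduceQ 0 2`: one parity per monomial) and the parities are affine (`a_e ≡ N + w·e (mod 2)`), then at `β² = −1`
`spec f β (evalT L) = β^N · (spec f β (evalT R₁))(β^w x)` with `R₁` RATIONAL (signs `β^{a − N − w·e} ∈ {1, β²} = {1, −1}`): one
rational state up to the torus.  Row kinds `nine c` (a v9 row) | **`pinqi γ d₀ A rts m w N`** (low coefficient
`A·T^{d₀}·∏(T−ρ)^k·(T²+1)^m`: terminal, or a pinned rational row, or — at `β² = −1` — the ι-torus representative `iotaRep w N L`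
as a later row); checker **`pcert10B q ext`**, soundness **`pwin_of_pcert10B`**, `rows_certified_of_pcert10B`, entry
**`rWins_liftState_of_pcert10B`**.

[OURS · counted 0 · certificate format + soundness; AI kernel work, weaker than expert review.]  NOTHING here is a statement
about resolution of singularities; resolution in dimension `≥ 4` / characteristic `p > 0` is NOT proved by anything in this
file.  bears_on: LADDER-RESOLUTION:D157-DOOR2 (res-dim4-pi · F4-C-loc all fields · rows v10).  Host item (DR-157-C):
`stmt-ResolutionOfSingularities-16155`, helper.
-/

set_option linter.dupNamespace false -- mandated namespace of this single-conjunct summit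

noncomputable section

open MvPolynomial Finset
open scoped BigOperators

namespace Summit.ResolutionOfSingularities.ResolutionOfSingularities.Theorems.PIDim4

namespace LoopCLocal

open Literature.AlgebraicGeometry.Resolution
open Literature.AlgebraicGeometry.Resolution.Hauser2010
open Literature.AlgebraicGeometry.Resolution.CentreBlowup
open StepKit ParamLift

section Format

variable {k : Type} [Field k] [DecidableEq k]

/-! ## §1 The format -/

/-- the residue `(a − N − w·e) mod 4`, written with naturals. OURS. [folklore] -/
def iotaRes (w : Fin 4 → ℕ) (N : ℕ) (t : (Fin 5 → ℕ) × k) : ℕ :=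
  (t.1 (Fin.last 4) + 3 * N + 3 * ∑ i : Fin 4, w i * t.1 i.castSucc) % 4

/-- the ι-torus representative: letter dropped, coefficient signed by the residue (`0 ↦ +`, `2 ↦ −`). OURS. [folklore] -/
def iotaRep (w : Fin 4 → ℕ) (N : ℕ) (R : Terms 5 k) : Terms 5 k :=
  R.map fun t => (Function.update t.1 (Fin.last 4) 0, if iotaRes w N t = 0 then t.2 else -t.2)

/-- a v10 row certificate. OURS. [folklore] -/
inductive PRowCert10 (k : Type) : Type
  /-- a v9 row -/
  | nine (c : PRowCert9 k)
  /-- quadratic pin at `T² + 1` with ι-torus continuation: low `γ`, coefficient `A·T^{d₀}·∏(T−ρ)^k·(T²+1)^m` -/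
  | pinqi (γ : Fin 4 → ℕ) (d₀ : ℕ) (A : k) (rts : List (k × ℕ)) (m : ℕ) (w : Fin 4 → ℕ) (N : ℕ)

/-- a v10 row. OURS. [folklore] -/
abbrev PRow10 (k : Type) : Type := Terms 5 k × PRowCert10 k

/-- projection to v9 rows (dummy certificates; only the term lists are read). OURS. [folklore] -/
def proj9 (rest : List (PRow10 k)) : List (PRow9 k) :=
  rest.map fun r => (r.1, PRowCert9.move ∅ fun _ => PNode9.child)

/-- the v10 row check (with external rows). OURS. [folklore] -/
def prow10B (q : ℕ) (ext : List (Terms 5 k)) (rest : List (PRow10 k)) : PRow10 k → Bool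
  | (L, PRowCert10.nine c) => prow9B q ext (proj9 rest) (L, c)
  | (L, PRowCert10.pinqi γ d₀ A rts m w N) =>
      let R := normT (reduceQ (0 : k) (-1) L)
      !decide (γ = 0) && decide (∑ i, γ i < q) && !decide (A = 0) &&
        decide (∀ t ∈ L, Fin.init t.1 = γ → t.1 (Fin.last 4) < (rootsPolyL A d₀ rts [((0 : k), (-1 : k), m)]).length) &&
        ((List.range (rootsPolyL A d₀ rts [((0 : k), (-1 : k), m)]).length).all fun a =>
          decide (tCoef γ L a = (rootsPolyL A d₀ rts [((0 : k), (-1 : k), m)]).getD a 0)) &&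
        decide (∀ ρm ∈ rts, memRowT (normT (pinT ρm.1 L)) ((proj9 rest).map Prod.fst ++ ext) = true) &&
        decide (∀ t ∈ R, iotaRes w N t = 0 ∨ iotaRes w N t = 2) &&
        memRowT (normT (iotaRep w N R)) ((proj9 rest).map Prod.fst ++ ext)

/-- **the v10 checker** (with external rows). OURS. [folklore] -/
def pcert10B (q : ℕ) (ext : List (Terms 5 k)) : List (PRow10 k) → Bool
  | [] => true
  | row :: rest => prow10B q ext rest row && pcert10B q ext rest

end Format

/-! ## §2 Soundness -/

section Sound

variable {k K : Type} [Field k] [Field K] [DecidableEq k] [DecidableEq K] (f : k →+* K)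

omit [Field k] [DecidableEq k] in
/-- the projection keeps the term lists. OURS. [folklore] -/
theorem map_fst_proj9 (rest : List (PRow10 k)) : (proj9 rest).map Prod.fst = rest.map Prod.fst := by
  unfold proj9
  rw [List.map_map]
  rfl

omit [DecidableEq k] in
/-- the induction hypothesis descends to the v9 projection. OURS. [folklore] -/
theorem hrest_proj9 {q : ℕ} {rest : List (PRow10 k)}
    (hrest : ∀ row ∈ rest, (∀ β : K, β ≠ 0 → ∀ (r : Fin 4 →₀ ℕ) (exc : Finset (Fin 4)),
      RWins q localB (⟨spec f β (evalT row.1), r, exc⟩ : State K))) :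
    ∀ row ∈ proj9 rest, (∀ β : K, β ≠ 0 → ∀ (r : Fin 4 →₀ ℕ) (exc : Finset (Fin 4)),
      RWins q localB (⟨spec f β (evalT row.1), r, exc⟩ : State K)) := by
  intro row hrow
  unfold proj9 at hrow
  obtain ⟨r, hr, rfl⟩ := List.mem_map.mp hrow
  exact hrest r hr

omit [DecidableEq k] [DecidableEq K] in
/-- with `β⁴ = 1`, powers of `β` only depend on the exponent mod 4. OURS. [folklore] -/
theorem pow_eq_pow_mod_four {β : K} (h4 : β ^ 4 = 1) (n : ℕ) : β ^ n = β ^ (n % 4) := by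
  conv_lhs => rw [← Nat.mod_add_div n 4, pow_add, pow_mul, h4, one_pow, mul_one]

omit [DecidableEq k] [DecidableEq K] in
/-- **the ι-torus identity of a term**: at `β² = −1`, `f c · β^a = β^N · ∏ (β^{wᵢ})^{eᵢ} · f (± c)` with the sign read from
`iotaRes`. OURS. [folklore] -/
theorem iota_term_identity {β : K} (hβ2 : β ^ 2 = -1) (w : Fin 4 → ℕ) (N : ℕ) (t : (Fin 5 → ℕ) × k)
    (hres : iotaRes w N t = 0 ∨ iotaRes w N t = 2) :
    f t.2 * β ^ t.1 (Fin.last 4) =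
      β ^ N * ((f (if iotaRes w N t = 0 then t.2 else -t.2)) * ∏ i : Fin 4, (β ^ w i) ^ t.1 i.castSucc) := by
  have h4 : β ^ 4 = 1 := by rw [show (4 : ℕ) = 2 * 2 from rfl, pow_mul, hβ2]; norm_num
  -- `β^a = β^{res} · β^{N + w·e}` from `a ≡ res + N + w·e (mod 4)`
  set S : ℕ := ∑ i : Fin 4, w i * t.1 i.castSucc with hS
  have hprod : (∏ i : Fin 4, (β ^ w i) ^ t.1 i.castSucc) = β ^ S := by
    rw [hS]
    simp_rw [← pow_mul]
    exact Finset.prod_pow_eq_pow_sum _ _ _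
  have hmod : β ^ t.1 (Fin.last 4) = β ^ iotaRes w N t * β ^ (N + S) := by
    rw [← pow_add, pow_eq_pow_mod_four h4 (t.1 (Fin.last 4)), pow_eq_pow_mod_four h4 (iotaRes w N t + (N + S))]
    congr 1
    unfold iotaRes
    rw [← hS]
    omega
  rw [hprod, hmod, pow_add]
  rcases hres with h0 | h2
  · rw [h0, if_pos rfl, pow_zero]; ring
  · rw [h2, if_neg (by norm_num), hβ2, map_neg]; ring

omit [DecidableEq k] [DecidableEq K] in
/-- **the ι-torus identity of a reduced row**: `spec f β (evalT R) = C (β^N) · (spec f β (evalT (iotaRep w N R)))(β^w x)` at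
`β² = −1`, when every residue is `0` or `2`. OURS. [folklore] -/
theorem spec_eq_iotaRep {β : K} (hβ2 : β ^ 2 = -1) (w : Fin 4 → ℕ) (N : ℕ) :
    ∀ R : Terms 5 k, (∀ t ∈ R, iotaRes w N t = 0 ∨ iotaRes w N t = 2) →
      spec f β (evalT R) =
        C (β ^ N) * aeval (fun i => C (β ^ w i) * X i) (spec f β (evalT (iotaRep w N R)))
  | [], _ => by simp [iotaRep]
  | t :: R, h => by
    have ih := spec_eq_iotaRep hβ2 w N R fun t' ht' => h t' (List.mem_cons_of_mem _ ht')
    have ht := h t List.mem_cons_self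
    simp only [iotaRep, List.map_cons, evalT_cons, map_add, mul_add] at ih ⊢
    rw [ih]
    congr 1
    have hL : spec f β (monomial (expo t.1) t.2) = monomial (expo (Fin.init t.1)) (f t.2 * β ^ t.1 (Fin.last 4)) := by
      rw [spec_monomial, C_mul_monomial, mul_one]
    have hR : C (β ^ N) * aeval (fun i => C (β ^ w i) * X i)
        (spec f β (monomial (expo (Function.update t.1 (Fin.last 4) 0)) (if iotaRes w N t = 0 then t.2 else -t.2))) =
        monomial (expo (Fin.init t.1)) (β ^ N * ((f (if iotaRes w N t = 0 then t.2 else -t.2)) *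
          ∏ i : Fin 4, (β ^ w i) ^ (expo (Fin.init t.1)) i)) := by
      rw [spec_monomial_update, pow_zero, mul_one, map_mul, aeval_C, algebraMap_eq, Torus.scale_monomial, one_mul,
        C_mul_monomial, C_mul_monomial]
    have hconv : (∏ i : Fin 4, (β ^ w i) ^ (expo (Fin.init t.1)) i) = ∏ i : Fin 4, (β ^ w i) ^ t.1 i.castSucc := rfl
    rw [hL, hR, hconv, iota_term_identity f hβ2 w N t ht]

/-- **soundness of the ι-TORUS pin row** against any certified term lists. OURS. [folklore] -/
theorem pwin_of_pinqi {q : ℕ} {rows : List (Terms 5 k)}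
    (hrows : ∀ L ∈ rows, (∀ β : K, β ≠ 0 → ∀ (r : Fin 4 →₀ ℕ) (exc : Finset (Fin 4)),
      RWins q localB (⟨spec f β (evalT L), r, exc⟩ : State K))) {L : Terms 5 k} {γ : Fin 4 → ℕ} {A : k}
    {d₀ : ℕ} {rts : List (k × ℕ)} {m : ℕ} {w : Fin 4 → ℕ} {N : ℕ} (hγq : ∑ i, γ i < q) (hA : A ≠ 0)
    (hM : ∀ t ∈ L, Fin.init t.1 = γ → t.1 (Fin.last 4) < (rootsPolyL A d₀ rts [((0 : k), (-1 : k), m)]).length)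
    (hcoef : ∀ a, a < (rootsPolyL A d₀ rts [((0 : k), (-1 : k), m)]).length →
      tCoef γ L a = (rootsPolyL A d₀ rts [((0 : k), (-1 : k), m)]).getD a 0)
    (hpins : ∀ ρm ∈ rts, memRowT (normT (pinT ρm.1 L)) rows = true)
    (hres : ∀ t ∈ normT (reduceQ (0 : k) (-1) L), iotaRes w N t = 0 ∨ iotaRes w N t = 2)
    (hrep : memRowT (normT (iotaRep w N (normT (reduceQ (0 : k) (-1) L)))) rows = true)
    {β : K} (hβ : β ≠ 0) (r : Fin 4 →₀ ℕ) (exc : Finset (Fin 4)) :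
    RWins q localB (⟨spec f β (evalT L), r, exc⟩ : State K) := by
  set Rp := rootsPolyL A d₀ rts [((0 : k), (-1 : k), m)] with hRp
  have hco : coeff (expo γ) (spec f β (evalT L)) = evalL f Rp β := by
    rw [coeff_spec_eq_sum_tCoef f β γ Rp.length L hM, evalL_eq_sum]
    exact Finset.sum_congr rfl fun a ha => by rw [hcoef a (Finset.mem_range.mp ha)]
  by_cases hzero : evalL f Rp β = 0
  · rcases root_cases_of_eval_eq_zero f hA hzero with ⟨-, hβ0⟩ | ⟨ρm, hρm, hβρ⟩ | ⟨c, hc, hβc⟩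
    · exact absurd hβ0 hβ
    · rw [hβρ, spec_pin_eq f ρm.1 β L, ← evalT_normT]
      exact pwin_of_memRowT f hrows (hpins ρm hρm) β hβ r exc
    · -- `β² = -1`: reduce, then scale the ι-family to its rational representative
      have hc' : c = ((0 : k), (-1 : k), m) := by simpa using hc
      subst hc'
      have hβ2 : β ^ 2 = -1 := by simpa using hβc
      rw [spec_normT_reduceQ_of_root f hβc L, spec_eq_iotaRep f hβ2 w N _ hres,
        Torus.rWins_C_mul_scale_iff (pow_ne_zero _ hβ) (fun i => pow_ne_zero _ hβ)]
      have hw := pwin_of_memRowT f hrows hrep β hβ r exc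
      rwa [evalT_normT] at hw
  · rw [← hco] at hzero
    exact Game.Wins.terminal fun S hS => not_isPermissibleCentre_of_coeff_ne_zero hγq hzero S hS.2

/-- **soundness of one v10 row.** OURS. [folklore] -/
theorem pwin_of_prow10B {q : ℕ} (hq : 2 ≤ q) {ext : List (Terms 5 k)} {rest : List (PRow10 k)}
    (hrest : ∀ row ∈ rest, (∀ β : K, β ≠ 0 → ∀ (r : Fin 4 →₀ ℕ) (exc : Finset (Fin 4)),
      RWins q localB (⟨spec f β (evalT row.1), r, exc⟩ : State K)))
    (hext : ∀ L ∈ ext, (∀ β : K, β ≠ 0 → ∀ (r : Fin 4 →₀ ℕ) (exc : Finset (Fin 4)),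
      RWins q localB (⟨spec f β (evalT L), r, exc⟩ : State K))) {row : PRow10 k}
    (h : prow10B q ext rest row = true) :
    (∀ β : K, β ≠ 0 → ∀ (r : Fin 4 →₀ ℕ) (exc : Finset (Fin 4)),
      RWins q localB (⟨spec f β (evalT row.1), r, exc⟩ : State K)) := by
  have hrest9 := hrest_proj9 f hrest
  have hrows : ∀ L ∈ (proj9 rest).map Prod.fst ++ ext, (∀ β : K, β ≠ 0 → ∀ (r : Fin 4 →₀ ℕ) (exc : Finset (Fin 4)),
      RWins q localB (⟨spec f β (evalT L), r, exc⟩ : State K)) := hrows_of_rest_ext f hrest9 hext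
  obtain ⟨L, cert⟩ := row
  intro β hβ r exc
  cases cert with
  | nine c =>
    simp only [prow10B] at h
    exact pwin_of_prow9B f hq hrest9 hext h β hβ r exc
  | pinqi γ d₀ A rts m w N =>
    simp only [prow10B, Bool.and_eq_true, Bool.not_eq_true', decide_eq_false_iff_not, decide_eq_true_eq,
      List.all_eq_true, List.mem_range] at h
    obtain ⟨⟨⟨⟨⟨⟨⟨-, hγq⟩, hA⟩, hM⟩, hcoef⟩, hpins⟩, hres⟩, hrep⟩ := h
    exact pwin_of_pinqi f hrows hγq hA hM hcoef hpins hres hrep hβ r exc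

/-- **SOUNDNESS OF v10 CERTIFICATES** (external rows certified by `hext`). OURS. [folklore] -/
theorem pwin_of_pcert10B {q : ℕ} (hq : 2 ≤ q) {ext : List (Terms 5 k)}
    (hext : ∀ L ∈ ext, (∀ β : K, β ≠ 0 → ∀ (r : Fin 4 →₀ ℕ) (exc : Finset (Fin 4)),
      RWins q localB (⟨spec f β (evalT L), r, exc⟩ : State K))) :
    ∀ {T : List (PRow10 k)}, pcert10B q ext T = true → ∀ row ∈ T,
      (∀ β : K, β ≠ 0 → ∀ (r : Fin 4 →₀ ℕ) (exc : Finset (Fin 4)),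
        RWins q localB (⟨spec f β (evalT row.1), r, exc⟩ : State K))
  | [], _ => fun row hrow => absurd hrow List.not_mem_nil
  | row :: rest, h => by
    unfold pcert10B at h
    rw [Bool.and_eq_true] at h
    have hrest := pwin_of_pcert10B hq hext h.2
    intro r hr
    rcases List.mem_cons.mp hr with rfl | hr'
    · exact pwin_of_prow10B f hq hrest hext h.1
    · exact hrest r hr'

/-- **chaining form**: the term lists of a checked v10 table are certified. OURS. [folklore] -/
theorem rows_certified_of_pcert10B {q : ℕ} (hq : 2 ≤ q) {ext : List (Terms 5 k)}
    (hext : ∀ L ∈ ext, (∀ β : K, β ≠ 0 → ∀ (r : Fin 4 →₀ ℕ) (exc : Finset (Fin 4)),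
      RWins q localB (⟨spec f β (evalT L), r, exc⟩ : State K))) {T : List (PRow10 k)} (h : pcert10B q ext T = true) :
    ∀ L ∈ T.map Prod.fst, (∀ β : K, β ≠ 0 → ∀ (r : Fin 4 →₀ ℕ) (exc : Finset (Fin 4)),
      RWins q localB (⟨spec f β (evalT L), r, exc⟩ : State K)) := by
  intro L hL
  obtain ⟨row, hrow, rfl⟩ := List.mem_map.mp hL
  exact pwin_of_pcert10B f hq hext h row hrow

end Sound

/-! ## §3 Entry point -/

/-- **an `𝔽₃` state whose embedding heads a checked v10 table (external rows certified) is a LOCAL A-win over the field `L` of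
characteristic 3.** OURS. [folklore] -/
theorem rWins_liftState_of_pcert10B (L : Type) [Field L] [CharP L 3] [DecidableEq L] {ext : List (Terms 5 (ZMod 3))}
    (hext : ∀ T5 ∈ ext, (∀ β : L, β ≠ 0 → ∀ (r : Fin 4 →₀ ℕ) (exc : Finset (Fin 4)),
      RWins 3 localB (⟨spec (φ3 L) β (evalT T5), r, exc⟩ : State L)))
    {s : SData 4 (ZMod 3)} {cert : PRowCert10 (ZMod 3)} {rest : List (PRow10 (ZMod 3))}
    (h : pcert10B 3 ext ((embed s.L, cert) :: rest) = true) : RWins 3 localB (liftState L s.toState) := by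
  have hw := pwin_of_pcert10B (φ3 L) (by norm_num) hext h (embed s.L, cert) List.mem_cons_self 1 one_ne_zero
    (expo s.r) s.exc
  rw [spec_embed] at hw
  exact hw

end LoopCLocal

end Summit.ResolutionOfSingularities.ResolutionOfSingularities.Theorems.PIDim4

end
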